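import Mathlib
import Summits.CriticalPhenomena.PercolationContinuityZ3.Theorems.PercNearOneGluingNoHeavyLowerTailFatMinorityPivotalComparison
import Summits.CriticalPhenomena.PercolationContinuityZ3.Theorems.PercNearOneGluingNoHeavyLowerTailFatMinorityRT4OfUT4
import Literature.Probability.Percolation.TwoClusterGibbsCovariance
import HarnessLib

/-!
# `NoHeavyLowerTail` (stmt-CriticalPhenomena-4575), line fat-minority-linear — PIVOTALITY CELLS for the slack
# edge lemma (route task `nh-dp-fatminority`, gen 11; step (B1) of PROOF-UT4-upto3ports.md)

`ν` a finite measure (a forced cell law `μ_{0,T}` in the application) on the pairs of `Fin n`; `o` the observer,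
`a` a port, `e = s(o,a)`, `c, b` vertices; `G_t = {ω | ω ∪ {e} ∈ {t ↔ b}}` the event that `t ↔ b` once `e` is glued.

* `glueEdge_openConn_eq`: `G_t = {t↔b} ∪ ({t↔o} ∩ {a↔b}) ∪ ({t↔a} ∩ {o↔b})` (`BHK2006.reachable_insert_pair`).
* `glueEdge_self_sdiff`, `glueEdge_third_sdiff(_disjoint)`: `G_a ∖ {a↔b} = {a↮o} ∩ {o↔b}` and
  `G_c ∖ {c↔b} = ({a↮o} ∩ {a↔b} ∩ {o↔c}) ⊔ ({a↮o} ∩ {o↔b} ∩ {a↔c})`.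
* `pivot_diff_eq`: `(ν G_a − ν{a↔b}) − (ν G_c − ν{c↔b}) = ν({a↮o} ∩ {o↔b} ∩ {a↮c}) − ν({a↮o} ∩ {a↔b} ∩ {o↔c})`
  — the cell pivotality difference `piv^T(a) − piv^T(c)` IS the bracket of `pivotalComparison` (gen 8, p194596).
* `cell_pivot_le`: hence, for a product law `ν = prodBernoulli W`,
  `(ν G_c − ν{c↔b}) − (ν G_a − ν{a↔b}) ≤ κ · (ν{a↔b} − ν{o↔b})`, `κ = ν({o↔c} | a↮o)` (`κ = 1` on a null condition).
No definitions.
-/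

namespace Summit.CriticalPhenomena.PercolationContinuityZ3.Theorems

open MeasureTheory Set
open Literature.Probability.LatticeModels (prodBernoulli)
open Literature.Probability.Percolation

noncomputable section
open scoped Classical

variable {n : ℕ}

/-- **Gluing one pair at the observer**: `t ↔ b` in `ω ∪ {s(o,a)}` iff `t ↔ b`, or `t ↔ o` and `a ↔ b`, or `t ↔ a`
and `o ↔ b` in `ω`. [cite: KozmaNitzan2024, Remark after Lemma 4, eq. (9) (pp. 9–10)] -/
theorem glueEdge_openConn_eq (o a t b : Fin n) (hoa : o ≠ a) :
    {ω : BondConfig (Fin n) | ((ω ∪ {s(o, a)} : Set (Sym2 (Fin n))) : BondConfig (Fin n)) ∈ openConn t b} =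
      openConn t b ∪ (openConn t o ∩ openConn a b) ∪ (openConn t a ∩ openConn o b) := by
  ext ω
  simp only [mem_setOf_eq, mem_union, mem_inter_iff, openConn, Set.union_singleton]
  constructor
  · intro h
    rcases BHK2006.reachable_insert_pair h with h1 | h2 | h3
    · exact Or.inl (Or.inl h1)
    · -- `o ↔ b` in `ω`; where does `t` attach?
      rcases BHK2006.reachable_insert_pair h.symm with k1 | k2 | k3
      · exact Or.inl (Or.inl k1.symm)
      · exact Or.inl (Or.inl (k2.symm.trans h2))
      · exact Or.inr ⟨k3.symm, h2⟩
    · rcases BHK2006.reachable_insert_pair h.symm with k1 | k2 | k3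
      · exact Or.inl (Or.inl k1.symm)
      · exact Or.inl (Or.inr ⟨k2.symm, h3⟩)
      · exact Or.inl (Or.inl (k3.symm.trans h3))
  · have hmono : ∀ {x y : Fin n}, (openGraph ω).Reachable x y →
        (openGraph (insert s(o, a) ω : BondConfig (Fin n))).Reachable x y :=
      fun h => h.mono (openGraph_mono (subset_insert _ _))
    have hadj : (openGraph (insert s(o, a) ω : BondConfig (Fin n))).Adj o a :=
      (openGraph_adj _ o a).2 ⟨mem_insert _ _, hoa⟩
    rintro ((h1 | ⟨h2, h3⟩) | ⟨h2, h3⟩)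
    · exact hmono h1
    · exact ((hmono h2).trans hadj.reachable).trans (hmono h3)
    · exact ((hmono h2).trans hadj.symm.reachable).trans (hmono h3)

/-- `G_a ∖ {a↔b} = {a↮o} ∩ {o↔b}`: the glued pair is pivotal for `a ↔ b` iff `o ↔ b` and `a ↮ o` (hence `a ↮ b`).
[cite: KozmaNitzan2024, Lemma 4 p. 9 (pivotality of an edge for its endpoint)] -/
theorem glueEdge_self_sdiff (o a b : Fin n) (hoa : o ≠ a) :
    {ω : BondConfig (Fin n) | ((ω ∪ {s(o, a)} : Set (Sym2 (Fin n))) : BondConfig (Fin n)) ∈ openConn a b} \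
        openConn a b = (openConn a o)ᶜ ∩ openConn o b := by
  rw [glueEdge_openConn_eq o a a b hoa]
  ext ω
  simp only [mem_sdiff, mem_union, mem_inter_iff, mem_compl_iff, openConn, mem_setOf_eq]
  constructor
  · rintro ⟨(hab | ⟨hao, hab⟩) | ⟨-, hob⟩, hnab⟩
    · exact (hnab hab).elim
    · exact (hnab hab).elim
    · exact ⟨fun hao => hnab (hao.trans hob), hob⟩
  · rintro ⟨hnao, hob⟩
    exact ⟨Or.inr ⟨SimpleGraph.Reachable.refl a, hob⟩, fun hab => hnao (hab.trans hob.symm)⟩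

/-- `G_c ∖ {c↔b} = ({a↮o} ∩ ({a↔b} ∩ {o↔c})) ∪ ({a↮o} ∩ ({o↔b} ∩ {a↔c}))`: the glued pair is pivotal for a
third vertex `c` iff `c` hangs on one endpoint and `b` on the other, the endpoints being separated.
[cite: KozmaNitzan2024, Lemma 4 p. 9 (pivotality of an edge for a third vertex)] -/
theorem glueEdge_third_sdiff (o a c b : Fin n) (hoa : o ≠ a) :
    {ω : BondConfig (Fin n) | ((ω ∪ {s(o, a)} : Set (Sym2 (Fin n))) : BondConfig (Fin n)) ∈ openConn c b} \
        openConn c b =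
      ((openConn a o)ᶜ ∩ (openConn a b ∩ openConn o c)) ∪ ((openConn a o)ᶜ ∩ (openConn o b ∩ openConn a c)) := by
  rw [glueEdge_openConn_eq o a c b hoa]
  ext ω
  simp only [mem_sdiff, mem_union, mem_inter_iff, mem_compl_iff, openConn, mem_setOf_eq]
  constructor
  · rintro ⟨(hcb | ⟨hco, hab⟩) | ⟨hca, hob⟩, hncb⟩
    · exact (hncb hcb).elim
    · exact Or.inl ⟨fun hao => hncb ((hco.trans hao.symm).trans hab), hab, hco.symm⟩
    · exact Or.inr ⟨fun hao => hncb ((hca.trans hao).trans hob), hob, hca.symm⟩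
  · rintro (⟨hnao, hab, hoc⟩ | ⟨hnao, hob, hac⟩)
    · exact ⟨Or.inl (Or.inr ⟨hoc.symm, hab⟩), fun hcb => hnao ((hab.trans hcb.symm).trans hoc.symm)⟩
    · exact ⟨Or.inr ⟨hac.symm, hob⟩, fun hcb => hnao ((hac.trans hcb).trans hob.symm)⟩

/-- The two pieces of `G_c ∖ {c↔b}` are disjoint (`o ↔ c ↔ a` would join the endpoints). [folklore] -/
theorem glueEdge_third_disjoint (o a c b : Fin n) :
    Disjoint ((openConn a o)ᶜ ∩ (openConn a b ∩ openConn o c) : Set (BondConfig (Fin n)))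
      ((openConn a o)ᶜ ∩ (openConn o b ∩ openConn a c)) := by
  rw [Set.disjoint_left]
  rintro ω ⟨hnao, -, hoc⟩ ⟨-, -, hac⟩
  exact hnao (hac.trans hoc.symm)

/-- **The cell pivotality difference is the pivotal-comparison bracket**: for any finite measure `ν`,
`(ν G_a − ν{a↔b}) − (ν G_c − ν{c↔b}) = ν({a↮o} ∩ ({o↔b} ∩ {a↮c})) − ν({a↮o} ∩ ({a↔b} ∩ {o↔c}))`.
[cite: KozmaNitzan2024, Lemma 4 p. 9; route notes gen 8 §4b (reduction of the edge lemma)] -/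
theorem pivot_diff_eq (ν : Measure (BondConfig (Fin n))) [IsFiniteMeasure ν] (o a c b : Fin n) (hoa : o ≠ a) :
    (ν.real {ω : BondConfig (Fin n) | ((ω ∪ {s(o, a)} : Set (Sym2 (Fin n))) : BondConfig (Fin n)) ∈ openConn a b} -
        ν.real (openConn a b)) -
      (ν.real {ω : BondConfig (Fin n) | ((ω ∪ {s(o, a)} : Set (Sym2 (Fin n))) : BondConfig (Fin n)) ∈ openConn c b} -
        ν.real (openConn c b)) =
      ν.real ((openConn a o)ᶜ ∩ (openConn o b ∩ (openConn a c)ᶜ)) -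
        ν.real ((openConn a o)ᶜ ∩ (openConn a b ∩ openConn o c)) := by
  set Ga : Set (BondConfig (Fin n)) :=
    {ω | ((ω ∪ {s(o, a)} : Set (Sym2 (Fin n))) : BondConfig (Fin n)) ∈ openConn a b} with hGa
  set Gc : Set (BondConfig (Fin n)) :=
    {ω | ((ω ∪ {s(o, a)} : Set (Sym2 (Fin n))) : BondConfig (Fin n)) ∈ openConn c b} with hGc
  -- `{t↔b} ⊆ G_t`
  have hsub : ∀ t : Fin n, (openConn t b : Set (BondConfig (Fin n))) ⊆
      {ω | ((ω ∪ {s(o, a)} : Set (Sym2 (Fin n))) : BondConfig (Fin n)) ∈ openConn t b} := by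
    intro t ω hω
    simp only [mem_setOf_eq, openConn] at hω ⊢
    exact hω.mono (openGraph_mono subset_union_left)
  have hma : MeasurableSet (openConn a b : Set (BondConfig (Fin n))) := MeasurableSet.of_discrete
  have hmc : MeasurableSet (openConn c b : Set (BondConfig (Fin n))) := MeasurableSet.of_discrete
  have h1 := measureReal_inter_add_sdiff (μ := ν) (s := Ga) hma
  have h2 := measureReal_inter_add_sdiff (μ := ν) (s := Gc) hmc
  rw [inter_eq_self_of_subset_right (hsub a)] at h1
  rw [inter_eq_self_of_subset_right (hsub c)] at h2
  rw [hGa, glueEdge_self_sdiff o a b hoa] at h1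
  rw [hGc, glueEdge_third_sdiff o a c b hoa,
    measureReal_union (glueEdge_third_disjoint o a c b) MeasurableSet.of_discrete] at h2
  -- split `{a↮o} ∩ {o↔b}` along `{a↔c}`
  have hmac : MeasurableSet (openConn a c : Set (BondConfig (Fin n))) := MeasurableSet.of_discrete
  have h3 := measureReal_inter_add_sdiff (μ := ν) (s := (openConn a o)ᶜ ∩ openConn o b) hmac
  rw [Set.sdiff_eq, inter_assoc, inter_assoc] at h3
  linarith

/-- **Cell inequality for the edge lemma.**  For a product law `ν = prodBernoulli W` (a forced cell law in the
application) and `κ = ν({a↮o} ∩ {o↔c}) / ν{a↮o}` (`κ = 1` if `ν{a↮o} = 0`):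
`(ν G_c − ν{c↔b}) − (ν G_a − ν{a↔b}) ≤ κ · (ν{a↔b} − ν{o↔b})` — the cell's `piv(c) − piv(a)` is at most `κ` times
the cell's reliability deficit of the blob `o`, by `pivotalComparison` (BHK Thm 1.4/1.5).
[cite: VandenbergHaggstromKahn2005, Thm. 1.4 and Thm. 1.5 (p. 7); KozmaNitzan2024, Lemma 4 p. 9] -/
theorem cell_pivot_le (W : Sym2 (Fin n) → unitInterval) (o a c b : Fin n) (hoa : o ≠ a) :
    ((prodBernoulli W).real {ω : BondConfig (Fin n) |
          ((ω ∪ {s(o, a)} : Set (Sym2 (Fin n))) : BondConfig (Fin n)) ∈ openConn c b} -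
        (prodBernoulli W).real (openConn c b)) -
      ((prodBernoulli W).real {ω : BondConfig (Fin n) |
          ((ω ∪ {s(o, a)} : Set (Sym2 (Fin n))) : BondConfig (Fin n)) ∈ openConn a b} -
        (prodBernoulli W).real (openConn a b)) ≤
      (if (prodBernoulli W).real (openConn a o)ᶜ = 0 then 1 else
          (prodBernoulli W).real ((openConn a o)ᶜ ∩ openConn o c) / (prodBernoulli W).real (openConn a o)ᶜ) *
        ((prodBernoulli W).real (openConn a b) - (prodBernoulli W).real (openConn o b)) := by
  set ν := prodBernoulli W with hν
  have hdiff := pivot_diff_eq ν o a c b hoa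
  have hpc := pivotalComparison W o a c b
  -- hpc : (ν ob − ν ab) * ν(D ∩ oc) ≤ ν D * (ν(D ∩ (ob ∩ (ac)ᶜ)) − ν(D ∩ (ab ∩ oc)))
  split_ifs with h0
  · -- null condition: the bracket vanishes and so does the deficit
    have hz1 : ν.real ((openConn a o)ᶜ ∩ (openConn o b ∩ (openConn a c)ᶜ)) = 0 :=
      le_antisymm ((measureReal_mono inter_subset_left).trans h0.le) measureReal_nonneg
    have hz2 : ν.real ((openConn a o)ᶜ ∩ (openConn a b ∩ openConn o c)) = 0 :=
      le_antisymm ((measureReal_mono inter_subset_left).trans h0.le) measureReal_nonneg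
    have hz3 := real_openConn_inter_eq_of_notConn_null ν a o b univ h0
    simp only [inter_univ] at hz3
    rw [hz3, sub_self, mul_zero]
    linarith
  · have hpos : 0 < ν.real (openConn a o)ᶜ := lt_of_le_of_ne measureReal_nonneg (Ne.symm h0)
    rw [div_mul_eq_mul_div, le_div_iff₀ hpos]
    nlinarith [hpc, hdiff]

end

end Summit.CriticalPhenomena.PercolationContinuityZ3.Theorems
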